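import Summits.QuantumFields.YangMills.Theorems.SwapVirialDeficitNearFlatPairs
import Summits.QuantumFields.YangMills.Theorems.VirialFluxGapAnchorSliceRotations
import Literature.MathematicalPhysics.QuantumFieldTheory.Balaban1983to89.T4QuatExpLog
import HarnessLib

/-!
# THE σ-WORD IDENTITY AND THE TWO PROJECTIONS OF THE SEAM (near-flat projection, σ-word half, part 1: letters)
# (free-hands support of ⟨stmt-QuantumFields-24197⟩ `SwapVirialDeficit.SwapGluedStiffness`; LEAD g98's plan of record memo7 §C(c) «near-flat projection lemma,
# Hölder 1/4 suffices», steps (iii)–(v) of width seat w3 g66's sketch MINUS the coaxialization step (ii) = ✓`NearFlat.exists_coaxial_near`)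

The flat bottom of sector 000 is `{C_μC_ν = C_νC_μ, cC₁ = C₀c, cC₀ = C₁c, cC₂ = C₂c}` (✓`chartDeficit_eq_zero_iff`).  After the leader triple has been made
COAXIAL (`C_μ = r_μ + t_μ·v` on one pure unit axis `v`, step (ii)), everything about the seam `c` is governed by ONE identity (§2):
`‖c(r₁ + t₁v) − (r₀ + t₀v)c‖² = ((r₁−r₀)² + (t₁−t₀)²)·P + ((r₁−r₀)² + (t₁+t₀)²)·Q`, `P = re(c)² + ⟪im c, v⟫² = ‖c_∥‖²` (the part of `c` in the
`v`-torus: STRATUM A, the seam commutes and `C₁ = C₀`), `Q = ‖im c‖² − ⟪im c, v⟫² = ‖c_⊥‖²` (the part orthogonal to the axis: STRATUM B, the seam is a Weyl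
reflection, `C₁ = C̄₀`, `C₂ = ±1`), `P + Q = ‖c‖² = 1`; the commutator word `cC₂ − C₂c` is `4t₂²·Q`.
* §1 coaxial elements (`coax_comm`, `sq_norm_coax`, `sq_norm_coax_sub_coax`, the nearest central corner `exists_central_near_coax`: `‖(r + tv) − σ‖² ≤ 2t²`);
* §2 ★ `sq_norm_sigmaWord_coax` (general pure axis, Lagrange), ★ `sq_norm_sigmaWord_coax_unit`, `sq_norm_comm_coax_unit`;
* §3 the projections of the seam: ★ `exists_coax_unit_near` (`P > 0`: a unit coaxial `c′` with `‖c − c′‖ ≤ 2√Q`), ★ `exists_orth_unit_near` (`Q > 0`: a PURE unit `c′`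
  ANTICOMMUTING with the axis, `‖c − c′‖ ≤ 2√P`; `mul_eq_neg_mul_of_inner_eq_zero`, `sigmaRel_of_anticomm[']`: `c′v = −vc′ ⟹ c′(r ∓ tv) = (r ± tv)c′`);
SEQUEL (`…SwapVirialDeficitNearFlatCoaxialProjection`): the three flat models (corner ∕ stratum A ∕ stratum B) and ★★ `exists_flat_near_of_coax` — σ-words
`≤ ε⁴` ⟹ an exactly flat unit tuple within `4ε` (Hölder `1/4`), plus the general near-central corner (step (iii)).
Reused from the tree: ✓`AnchorSlice.norm_coe_add_smul_pure_sq` (`‖r + t·v‖² = r² + t²`), ✓`T4QuatExpLog.mul_eq_neg_mul_of_inner_eq_zero` (orthogonal pure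
quaternions anticommute), ✓`NearFlat.norm_sq_coe_add_pure` ∕ `commute_of_coaxial`'s letters.

HONEST LABEL: elementary quaternion geometry; stubs B ∕ core ∕ 001 of skeleton ➎, ⟨24197⟩ ∕ ⟨24194⟩ ∕ ⟨24497⟩ OPEN; own crux ⟨22884⟩ `LargeFieldMassRefinementTail`
OPEN (blocked-on ⟨19935⟩); the Yang–Mills mass gap is NOT proved; no summit is proved by a line.  THEOREMS ONLY (0 `def`, 0 `sorry`), standard axioms.
LEAD seat ym-line-sfw-p2 g99 (cell ym-idea-1, free hands), `--supports stmt-QuantumFields-24197`.  References: [folklore].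
-/


set_option autoImplicit false

noncomputable section

open Quaternion
open scoped Quaternion RealInnerProductSpace
open Literature.MathematicalPhysics.QuantumFieldTheory.DybalskiStottmeisterTanimoto2024.DST24CriticalPoint (inner_eq_components)
open Literature.MathematicalPhysics.QuantumLattice (sq_norm_eq_sum_sq)
open Literature.MathematicalPhysics.QuantumFieldTheory.Balaban1983to89.T4QuatExpLog (mul_eq_neg_mul_of_inner_eq_zero)
open Summit.QuantumFields.YangMills.Theorems.VirialFluxGap.AnchorSlice (norm_coe_add_smul_pure_sq)

namespace Summit.QuantumFields.YangMills.Theorems.SwapVirialDeficit.NearFlat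

/-! ## §1 Coaxial elements `r + t·v` over a pure axis `v` -/

/-- Two elements coaxial with the same `v` commute: `(r + t·v)(r′ + t′·v) = (r′ + t′·v)(r + t·v)`. [folklore] -/
theorem coax_comm (v : ℍ) (r t r' t' : ℝ) :
    ((r : ℍ) + t • v) * ((r' : ℍ) + t' • v) = ((r' : ℍ) + t' • v) * ((r : ℍ) + t • v) := by
  ext <;> simp <;> ring

/-- A real (central) quaternion commutes with everything. [folklore] -/
theorem coe_comm (σ : ℝ) (q : ℍ) : (σ : ℍ) * q = q * (σ : ℍ) := Quaternion.coe_commutes σ q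

/-- `‖(r₁ + t₁·v) − (r₀ + t₀·v)‖² = (r₁−r₀)² + (t₁−t₀)²` for a pure unit axis `v`. [folklore] -/
theorem sq_norm_coax_sub_coax {v : ℍ} (hv : v.re = 0) (hv1 : ‖v‖ = 1) (r₀ t₀ r₁ t₁ : ℝ) :
    ‖((r₁ : ℍ) + t₁ • v) - ((r₀ : ℍ) + t₀ • v)‖ ^ 2 = (r₁ - r₀) ^ 2 + (t₁ - t₀) ^ 2 := by
  have e : ((r₁ : ℍ) + t₁ • v) - ((r₀ : ℍ) + t₀ • v) = ((r₁ - r₀ : ℝ) : ℍ) + (t₁ - t₀) • v := by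
    rw [Quaternion.coe_sub, sub_smul]; abel
  rw [e, norm_coe_add_smul_pure_sq hv hv1]

/-- THE NEAREST CENTRAL CORNER of a unit coaxial element: for `r² + t² = 1` there is `σ = ±1` with `‖(r + t·v) − σ‖² ≤ 2t²`. [folklore] -/
theorem exists_central_near_coax {v : ℍ} (hv : v.re = 0) (hv1 : ‖v‖ = 1) {r t : ℝ} (h : r ^ 2 + t ^ 2 = 1) :
    ∃ σ : ℝ, σ ^ 2 = 1 ∧ ‖((r : ℍ) + t • v) - (σ : ℍ)‖ ^ 2 ≤ 2 * t ^ 2 := by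
  have key : ∀ σ : ℝ, σ ^ 2 = 1 → 0 ≤ σ * r → ‖((r : ℍ) + t • v) - (σ : ℍ)‖ ^ 2 ≤ 2 * t ^ 2 := by
    intro σ hσ hσr
    have e : ((r : ℍ) + t • v) - (σ : ℍ) = ((r - σ : ℝ) : ℍ) + t • v := by
      rw [Quaternion.coe_sub]; abel
    rw [e, norm_coe_add_smul_pure_sq hv hv1]
    -- `(r − σ)² + t² = 2 − 2σr ≤ 2 − 2r² = 2t²` since `σr = |r| ≥ r²`
    have hr1 : r ^ 2 ≤ 1 := by nlinarith [sq_nonneg t]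
    have habs : r ^ 2 ≤ σ * r := by
      have : (σ * r) ^ 2 = r ^ 2 := by rw [mul_pow, hσ, one_mul]
      nlinarith [sq_nonneg (σ * r - 1)]
    nlinarith
  by_cases hr : 0 ≤ r
  · exact ⟨1, by norm_num, key 1 (by norm_num) (by simpa using hr)⟩
  · exact ⟨-1, by norm_num, key (-1) (by norm_num) (by nlinarith [(not_le.mp hr).le])⟩

/-! ## §2 The σ-word identity -/

/-- ★ **THE σ-WORD IDENTITY** (general pure axis `v`, any `c`): `‖c(r₁ + t₁v) − (r₀ + t₀v)c‖² = (r₁−r₀)²‖c‖² + (t₁−t₀)²(c.re²‖v‖² + ⟪im c, v⟫²)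
+ (t₁+t₀)²(‖im c‖²‖v‖² − ⟪im c, v⟫²)` — the real part and the `v`-component of `c` see the DIFFERENCE of the angles (stratum A), the part of `im c`
orthogonal to `v` sees their SUM (stratum B: `c` a Weyl reflection of the axis); Lagrange's identity for `|im c × v|²`. [folklore] -/
theorem sq_norm_sigmaWord_coax (v : ℍ) (hv : v.re = 0) (c : ℍ) (r₀ t₀ r₁ t₁ : ℝ) :
    ‖c * ((r₁ : ℍ) + t₁ • v) - ((r₀ : ℍ) + t₀ • v) * c‖ ^ 2 =
      (r₁ - r₀) ^ 2 * ‖c‖ ^ 2 + (t₁ - t₀) ^ 2 * (c.re ^ 2 * ‖v‖ ^ 2 + ⟪c.im, v⟫ ^ 2) +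
        (t₁ + t₀) ^ 2 * (‖c.im‖ ^ 2 * ‖v‖ ^ 2 - ⟪c.im, v⟫ ^ 2) := by
  rw [sq_norm_eq_sum_sq, sq_norm_eq_sum_sq c, sq_norm_eq_sum_sq v, sq_norm_eq_sum_sq c.im, inner_eq_components]
  simp only [Quaternion.re_im, Quaternion.imI_im, Quaternion.imJ_im, Quaternion.imK_im, hv,
    Quaternion.re_sub, Quaternion.imI_sub, Quaternion.imJ_sub, Quaternion.imK_sub,
    Quaternion.re_mul, Quaternion.imI_mul, Quaternion.imJ_mul, Quaternion.imK_mul,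
    Quaternion.re_add, Quaternion.imI_add, Quaternion.imJ_add, Quaternion.imK_add,
    Quaternion.re_smul, Quaternion.imI_smul, Quaternion.imJ_smul, Quaternion.imK_smul,
    Quaternion.re_coe, Quaternion.imI_coe, Quaternion.imJ_coe, Quaternion.imK_coe, smul_eq_mul]
  ring

/-- ★ **THE σ-WORD IDENTITY ON A UNIT AXIS**: `‖c(r₁ + t₁v) − (r₀ + t₀v)c‖² = ((r₁−r₀)² + (t₁−t₀)²)·P + ((r₁−r₀)² + (t₁+t₀)²)·Q` with the A-weight
`P = c.re² + ⟪im c, v⟫²` (squared norm of the part of `c` coaxial with `v`) and the B-weight `Q = ‖im c‖² − ⟪im c, v⟫²` (the part orthogonal to the axis);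
`P + Q = ‖c‖²`.  The word `cC₂ − C₂c` is the case `(r₁,t₁) = (r₀,t₀)`: `4t₂²·Q`. [folklore] -/
theorem sq_norm_sigmaWord_coax_unit {v : ℍ} (hv : v.re = 0) (hv1 : ‖v‖ = 1) (c : ℍ) (r₀ t₀ r₁ t₁ : ℝ) :
    ‖c * ((r₁ : ℍ) + t₁ • v) - ((r₀ : ℍ) + t₀ • v) * c‖ ^ 2 =
      ((r₁ - r₀) ^ 2 + (t₁ - t₀) ^ 2) * (c.re ^ 2 + ⟪c.im, v⟫ ^ 2) +
        ((r₁ - r₀) ^ 2 + (t₁ + t₀) ^ 2) * (‖c.im‖ ^ 2 - ⟪c.im, v⟫ ^ 2) := by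
  have hc2 : ‖c‖ ^ 2 = c.re ^ 2 + ‖c.im‖ ^ 2 := by
    rw [sq_norm_eq_sum_sq c, sq_norm_eq_sum_sq c.im, Quaternion.re_im, Quaternion.imI_im, Quaternion.imJ_im, Quaternion.imK_im]; ring
  rw [sq_norm_sigmaWord_coax v hv, hv1, hc2]; ring

/-- The commutator word of a coaxial element with `c`: `‖c(r + tv) − (r + tv)c‖² = 4t²·Q`. [folklore] -/
theorem sq_norm_comm_coax_unit {v : ℍ} (hv : v.re = 0) (hv1 : ‖v‖ = 1) (c : ℍ) (r t : ℝ) :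
    ‖c * ((r : ℍ) + t • v) - ((r : ℍ) + t • v) * c‖ ^ 2 = 4 * t ^ 2 * (‖c.im‖ ^ 2 - ⟪c.im, v⟫ ^ 2) := by
  rw [sq_norm_sigmaWord_coax_unit hv hv1]; ring


/-- A real `σ` with `σ² = 1` is a unit quaternion. [folklore] -/
theorem norm_coe_of_sq_eq_one {σ : ℝ} (hσ : σ ^ 2 = 1) : ‖(σ : ℍ)‖ = 1 := by
  rw [Quaternion.norm_coe, Real.norm_eq_abs]
  have h : |σ| ^ 2 = 1 ^ 2 := by rw [sq_abs, hσ, one_pow]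
  exact (pow_left_inj₀ (abs_nonneg σ) zero_le_one two_ne_zero).1 h

/-- A quaternion of squared norm `1` has norm `1`. [folklore] -/
theorem norm_eq_one_of_sq {q : ℍ} (h : ‖q‖ ^ 2 = 1) : ‖q‖ = 1 :=
  (pow_left_inj₀ (norm_nonneg q) zero_le_one two_ne_zero).1 (by rw [h, one_pow])

/-- `‖x‖² ≤ ε²`, `0 ≤ ε` ⟹ `‖x‖ ≤ ε`. [folklore] -/
theorem norm_le_of_sq_le {x : ℍ} {ε : ℝ} (hε : 0 ≤ ε) (h : ‖x‖ ^ 2 ≤ ε ^ 2) : ‖x‖ ≤ ε :=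
  (pow_le_pow_iff_left₀ (norm_nonneg x) hε two_ne_zero).1 h

/-! ## §3 The coaxial part `c_∥ = re c + ⟪im c, v⟫·v` and the orthogonal part `c_⊥ = im c − ⟪im c, v⟫·v` of the seam -/

/-- `P + Q = ‖c‖²` for the A-weight `P = re² + ⟪im c, v⟫²` and the B-weight `Q = ‖im c‖² − ⟪im c, v⟫²`. [folklore] -/
theorem weightA_add_weightB (v c : ℍ) : (c.re ^ 2 + ⟪c.im, v⟫ ^ 2) + (‖c.im‖ ^ 2 - ⟪c.im, v⟫ ^ 2) = ‖c‖ ^ 2 := by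
  have hc2 : ‖c‖ ^ 2 = c.re ^ 2 + ‖c.im‖ ^ 2 := by
    rw [sq_norm_eq_sum_sq c, sq_norm_eq_sum_sq c.im, Quaternion.re_im, Quaternion.imI_im, Quaternion.imJ_im, Quaternion.imK_im]; ring
  rw [hc2]; ring

/-- The B-weight is nonnegative on a unit axis (Cauchy–Schwarz). [folklore] -/
theorem weightB_nonneg {v : ℍ} (hv1 : ‖v‖ = 1) (c : ℍ) : 0 ≤ ‖c.im‖ ^ 2 - ⟪c.im, v⟫ ^ 2 := by
  have h := abs_real_inner_le_norm c.im v
  rw [hv1, mul_one] at h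
  have h2 : ⟪c.im, v⟫ ^ 2 ≤ ‖c.im‖ ^ 2 := by
    rw [← sq_abs]; exact pow_le_pow_left₀ (abs_nonneg _) h 2
  linarith

/-- The orthogonal part is pure imaginary. [folklore] -/
theorem orthPart_re {v : ℍ} (hv : v.re = 0) (c : ℍ) : (c.im - ⟪c.im, v⟫ • v).re = 0 := by
  simp [hv]

/-- The orthogonal part is orthogonal to the (unit) axis. [folklore] -/
theorem inner_orthPart {v : ℍ} (hv1 : ‖v‖ = 1) (c : ℍ) : ⟪c.im - ⟪c.im, v⟫ • v, v⟫ = 0 := by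
  rw [inner_sub_left, real_inner_smul_left, real_inner_self_eq_norm_sq, hv1]
  ring

/-- `‖c_⊥‖² = Q`. [folklore] -/
theorem sq_norm_orthPart {v : ℍ} (hv1 : ‖v‖ = 1) (c : ℍ) : ‖c.im - ⟪c.im, v⟫ • v‖ ^ 2 = ‖c.im‖ ^ 2 - ⟪c.im, v⟫ ^ 2 := by
  rw [@norm_sub_sq_real, inner_smul_right, norm_smul, hv1, mul_one, Real.norm_eq_abs, sq_abs]; ring

/-- `c = c_∥ + c_⊥`. [folklore] -/
theorem coaxPart_add_orthPart (v c : ℍ) : ((c.re : ℍ) + ⟪c.im, v⟫ • v) + (c.im - ⟪c.im, v⟫ • v) = c := by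
  rw [add_add_sub_cancel, Quaternion.re_add_im]

/-- A seam anticommuting with the axis realises the B-type σ-relation: `c′v = −vc′` ⟹ `c′(r − t·v) = (r + t·v)c′`. [folklore] -/
theorem sigmaRel_of_anticomm {c' v : ℍ} (h : c' * v = -(v * c')) (r t : ℝ) :
    c' * ((r : ℍ) + (-t) • v) = ((r : ℍ) + t • v) * c' := by
  calc c' * ((r : ℍ) + (-t) • v) = c' * (r : ℍ) + (-t) • (c' * v) := by rw [mul_add, mul_smul_comm]
    _ = (r : ℍ) * c' + (-t) • (-(v * c')) := by rw [← Quaternion.coe_commutes r c', h]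
    _ = (r : ℍ) * c' + t • (v * c') := by rw [smul_neg, neg_smul, neg_neg]
    _ = ((r : ℍ) + t • v) * c' := by rw [add_mul, smul_mul_assoc]

/-- The same with the roles of `±t` exchanged: `c′v = −vc′` ⟹ `c′(r + t·v) = (r − t·v)c′`. [folklore] -/
theorem sigmaRel_of_anticomm' {c' v : ℍ} (h : c' * v = -(v * c')) (r t : ℝ) :
    c' * ((r : ℍ) + t • v) = ((r : ℍ) + (-t) • v) * c' := by
  have := sigmaRel_of_anticomm h r (-t)
  rwa [neg_neg] at this

/-- ★ **THE COAXIAL PROJECTION OF THE SEAM** (branch A): for a unit `c` with A-weight `P > 0` there is a UNIT element `r + t·v` coaxial with the axis with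
`‖c − (r + t·v)‖ ≤ 2√Q` (`c_∥/‖c_∥‖`: the move costs `‖c_⊥‖ + (1 − ‖c_∥‖) ≤ √Q + Q`). [folklore] -/
theorem exists_coax_unit_near {v : ℍ} (hv : v.re = 0) (hv1 : ‖v‖ = 1) {c : ℍ} (hc : ‖c‖ = 1) (hP : 0 < c.re ^ 2 + ⟪c.im, v⟫ ^ 2) :
    ∃ r t : ℝ, r ^ 2 + t ^ 2 = 1 ∧ ‖c - ((r : ℍ) + t • v)‖ ≤ 2 * Real.sqrt (‖c.im‖ ^ 2 - ⟪c.im, v⟫ ^ 2) := by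
  have hPQ : (c.re ^ 2 + ⟪c.im, v⟫ ^ 2) + (‖c.im‖ ^ 2 - ⟪c.im, v⟫ ^ 2) = 1 := by rw [weightA_add_weightB, hc, one_pow]
  have hQ0 : 0 ≤ ‖c.im‖ ^ 2 - ⟪c.im, v⟫ ^ 2 := weightB_nonneg hv1 c
  have hpar0 : ‖(c.re : ℍ) + ⟪c.im, v⟫ • v‖ ^ 2 = c.re ^ 2 + ⟪c.im, v⟫ ^ 2 := norm_coe_add_smul_pure_sq hv hv1 c.re ⟪c.im, v⟫
  have hort0 : ‖c.im - ⟪c.im, v⟫ • v‖ ^ 2 = ‖c.im‖ ^ 2 - ⟪c.im, v⟫ ^ 2 := sq_norm_orthPart hv1 c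
  -- the identity `c − s⁻¹·c_∥ = c_⊥ + (1 − s⁻¹)·c_∥` for every real `s`
  have e : ∀ s : ℝ, c - (((s⁻¹ * c.re : ℝ) : ℍ) + (s⁻¹ * ⟪c.im, v⟫) • v) =
      (c.im - ⟪c.im, v⟫ • v) + (1 - s⁻¹) • ((c.re : ℍ) + ⟪c.im, v⟫ • v) := by
    intro s
    ext <;> simp only [Quaternion.re_sub, Quaternion.imI_sub, Quaternion.imJ_sub, Quaternion.imK_sub,
      Quaternion.re_add, Quaternion.imI_add, Quaternion.imJ_add, Quaternion.imK_add,
      Quaternion.re_smul, Quaternion.imI_smul, Quaternion.imJ_smul, Quaternion.imK_smul,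
      Quaternion.re_coe, Quaternion.imI_coe, Quaternion.imJ_coe, Quaternion.imK_coe,
      Quaternion.re_im, Quaternion.imI_im, Quaternion.imJ_im, Quaternion.imK_im, smul_eq_mul] <;> ring
  obtain ⟨P, hPdef⟩ : ∃ P : ℝ, c.re ^ 2 + ⟪c.im, v⟫ ^ 2 = P := ⟨_, rfl⟩
  obtain ⟨Q, hQdef⟩ : ∃ Q : ℝ, ‖c.im‖ ^ 2 - ⟪c.im, v⟫ ^ 2 = Q := ⟨_, rfl⟩
  rw [hPdef] at hP hPQ hpar0
  rw [hQdef] at hQ0 hPQ hort0 ⊢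
  obtain ⟨s, hsdef⟩ : ∃ s : ℝ, Real.sqrt P = s := ⟨_, rfl⟩
  have hs0 : 0 < s := by rw [← hsdef]; exact Real.sqrt_pos.2 hP
  have hsP : s ^ 2 = P := by rw [← hsdef]; exact Real.sq_sqrt hP.le
  have hs1 : s ≤ 1 := by rw [← hsdef]; exact Real.sqrt_le_one.mpr (by linarith)
  have hpar : ‖(c.re : ℍ) + ⟪c.im, v⟫ • v‖ = s := by
    rw [← hsdef, ← hpar0, Real.sqrt_sq (norm_nonneg _)]
  have hort : ‖c.im - ⟪c.im, v⟫ • v‖ = Real.sqrt Q := by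
    rw [← hort0, Real.sqrt_sq (norm_nonneg _)]
  refine ⟨s⁻¹ * c.re, s⁻¹ * ⟪c.im, v⟫, ?_, ?_⟩
  · rw [mul_pow, mul_pow, ← mul_add, hPdef, ← hsP, inv_pow, inv_mul_cancel₀ (pow_ne_zero 2 hs0.ne')]
  · have hn2 : ‖(1 - s⁻¹) • ((c.re : ℍ) + ⟪c.im, v⟫ • v)‖ = 1 - s := by
      rw [norm_smul, hpar, Real.norm_eq_abs]
      have h1 : (1 - s⁻¹) * s = s - 1 := by field_simp
      rw [← abs_of_pos hs0, ← abs_mul, abs_of_pos hs0, h1, abs_sub_comm, abs_of_nonneg (by linarith)]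
    have hQ1 : Q ≤ 1 := by linarith [hP.le]
    have h1s : 1 - s ≤ Real.sqrt Q := by
      have hPs : P ≤ s := by nlinarith
      have h2 : 1 - s ≤ Q := by linarith
      have hQs : Q ≤ Real.sqrt Q := by nlinarith [Real.sq_sqrt hQ0, Real.sqrt_nonneg Q, Real.sqrt_le_one.mpr hQ1]
      exact h2.trans hQs
    calc ‖c - (((s⁻¹ * c.re : ℝ) : ℍ) + (s⁻¹ * ⟪c.im, v⟫) • v)‖
        = ‖(c.im - ⟪c.im, v⟫ • v) + (1 - s⁻¹) • ((c.re : ℍ) + ⟪c.im, v⟫ • v)‖ := by rw [e]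
      _ ≤ ‖c.im - ⟪c.im, v⟫ • v‖ + ‖(1 - s⁻¹) • ((c.re : ℍ) + ⟪c.im, v⟫ • v)‖ := norm_add_le _ _
      _ = Real.sqrt Q + (1 - s) := by rw [hort, hn2]
      _ ≤ 2 * Real.sqrt Q := by linarith

/-- ★ **THE ORTHOGONAL PROJECTION OF THE SEAM** (branch B): for a unit `c` with B-weight `Q > 0` there is a PURE UNIT `c′` ANTICOMMUTING with the axis
(`c′v = −vc′`, a Weyl reflection of the `v`-torus) with `‖c − c′‖ ≤ 2√P` (`c_⊥/‖c_⊥‖`). [folklore] -/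
theorem exists_orth_unit_near {v : ℍ} (hv : v.re = 0) (hv1 : ‖v‖ = 1) {c : ℍ} (hc : ‖c‖ = 1) (hQ : 0 < ‖c.im‖ ^ 2 - ⟪c.im, v⟫ ^ 2) :
    ∃ c' : ℍ, ‖c'‖ = 1 ∧ c'.re = 0 ∧ c' * v = -(v * c') ∧ ‖c - c'‖ ≤ 2 * Real.sqrt (c.re ^ 2 + ⟪c.im, v⟫ ^ 2) := by
  have hPQ : (c.re ^ 2 + ⟪c.im, v⟫ ^ 2) + (‖c.im‖ ^ 2 - ⟪c.im, v⟫ ^ 2) = 1 := by rw [weightA_add_weightB, hc, one_pow]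
  have hP0 : 0 ≤ c.re ^ 2 + ⟪c.im, v⟫ ^ 2 := by positivity
  have hpar0 : ‖(c.re : ℍ) + ⟪c.im, v⟫ • v‖ ^ 2 = c.re ^ 2 + ⟪c.im, v⟫ ^ 2 := norm_coe_add_smul_pure_sq hv hv1 c.re ⟪c.im, v⟫
  have hort0 : ‖c.im - ⟪c.im, v⟫ • v‖ ^ 2 = ‖c.im‖ ^ 2 - ⟪c.im, v⟫ ^ 2 := sq_norm_orthPart hv1 c
  have hwre : (c.im - ⟪c.im, v⟫ • v).re = 0 := orthPart_re hv c
  have hwv : (c.im - ⟪c.im, v⟫ • v) * v = -(v * (c.im - ⟪c.im, v⟫ • v)) :=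
    mul_eq_neg_mul_of_inner_eq_zero hwre hv (inner_orthPart hv1 c)
  -- the identity `c − s⁻¹·c_⊥ = c_∥ + (1 − s⁻¹)·c_⊥` for every real `s`
  have e : ∀ s : ℝ, c - s⁻¹ • (c.im - ⟪c.im, v⟫ • v) = ((c.re : ℍ) + ⟪c.im, v⟫ • v) + (1 - s⁻¹) • (c.im - ⟪c.im, v⟫ • v) := by
    intro s
    ext <;> simp <;> ring
  obtain ⟨w, hwdef⟩ : ∃ w : ℍ, c.im - ⟪c.im, v⟫ • v = w := ⟨_, rfl⟩
  rw [hwdef] at hort0 hwre hwv e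
  obtain ⟨P, hPdef⟩ : ∃ P : ℝ, c.re ^ 2 + ⟪c.im, v⟫ ^ 2 = P := ⟨_, rfl⟩
  obtain ⟨Q, hQdef⟩ : ∃ Q : ℝ, ‖c.im‖ ^ 2 - ⟪c.im, v⟫ ^ 2 = Q := ⟨_, rfl⟩
  rw [hPdef] at hP0 hPQ hpar0 ⊢
  rw [hQdef] at hQ hPQ hort0
  obtain ⟨s, hsdef⟩ : ∃ s : ℝ, Real.sqrt Q = s := ⟨_, rfl⟩
  have hs0 : 0 < s := by rw [← hsdef]; exact Real.sqrt_pos.2 hQ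
  have hsQ : s ^ 2 = Q := by rw [← hsdef]; exact Real.sq_sqrt hQ.le
  have hs1 : s ≤ 1 := by rw [← hsdef]; exact Real.sqrt_le_one.mpr (by linarith)
  have hpar : ‖(c.re : ℍ) + ⟪c.im, v⟫ • v‖ = Real.sqrt P := by
    rw [← hpar0, Real.sqrt_sq (norm_nonneg _)]
  have hort : ‖w‖ = s := by
    rw [← hsdef, ← hort0, Real.sqrt_sq (norm_nonneg _)]
  refine ⟨s⁻¹ • w, ?_, ?_, ?_, ?_⟩
  · rw [norm_smul, hort, Real.norm_eq_abs, abs_of_pos (inv_pos.2 hs0), inv_mul_cancel₀ hs0.ne']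
  · rw [Quaternion.re_smul, hwre, smul_zero]
  · rw [smul_mul_assoc, hwv, mul_smul_comm, smul_neg]
  · have hn2 : ‖(1 - s⁻¹) • w‖ = 1 - s := by
      rw [norm_smul, hort, Real.norm_eq_abs]
      have h1 : (1 - s⁻¹) * s = s - 1 := by field_simp
      rw [← abs_of_pos hs0, ← abs_mul, abs_of_pos hs0, h1, abs_sub_comm, abs_of_nonneg (by linarith)]
    have hP1 : P ≤ 1 := by linarith [hQ.le]
    have h1s : 1 - s ≤ Real.sqrt P := by
      have hQs : Q ≤ s := by nlinarith
      have h2 : 1 - s ≤ P := by linarith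
      have hPs' : P ≤ Real.sqrt P := by nlinarith [Real.sq_sqrt hP0, Real.sqrt_nonneg P, Real.sqrt_le_one.mpr hP1]
      exact h2.trans hPs'
    calc ‖c - s⁻¹ • w‖ = ‖((c.re : ℍ) + ⟪c.im, v⟫ • v) + (1 - s⁻¹) • w‖ := by rw [e]
      _ ≤ ‖(c.re : ℍ) + ⟪c.im, v⟫ • v‖ + ‖(1 - s⁻¹) • w‖ := norm_add_le _ _
      _ = Real.sqrt P + (1 - s) := by rw [hpar, hn2]
      _ ≤ 2 * Real.sqrt P := by linarith


end Summit.QuantumFields.YangMills.Theorems.SwapVirialDeficit.NearFlat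

end
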